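import Summits.QuantumFields.YangMills.Theorems.NPointIsotropy.Negative.JunkFamily
import Literature.Analysis.Distribution.FourierLaplaceHolomorphic

/-!
# Negative results on `PencilRigidity.NPointIsotropy`, III: invariances of the junk family; the rotation `R₀`

Support file 3/4 (stmt-QuantumFields-11686). E3, translation invariance, FULL hypercubic invariance and E0'
of the junk family (re-indexing of the `W(B₄) × S₄`-symmetrisation; temperedness of `J`), and the rotation
`R₀` of the `(e₀,e₁)`-plane with `R₀ e₀ = (3e₀ + 4e₁)/5`, built as the product of the mirrors `⊥ e₁` and
`⊥ (e₀ - f0)`: determinant `1`, fixes `e₂, e₃`.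
-/

noncomputable section

-- Mathlib's `SimplexCategory` instance `Fintype (Fin (x.len + 1))` matches `Fintype (Fin 4)` and makes concrete
-- `Fin 4` instance paths diverge between elaborations (tree-known workaround, cf.
-- `Literature/Geometry/Riemannian/PieceMetricLocalExtension.lean`).
attribute [-instance] SimplexCategory.instFintypeToTypeOrderHomFinHAddNatLenOfNat

namespace Summit.QuantumFields.YangMills.Theorems.NPointIsotropy.Negative

open scoped BigOperators ComplexConjugate InnerProductSpace
open MeasureTheory Filter Topology
open Literature.MathematicalPhysics.QuantumLattice Literature.MathematicalPhysics.AQFT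
  Literature.MathematicalPhysics.QuantumFieldTheory

/-- `J` is symmetric under permutations of the four arguments (re-indexing of the `S₄`-sum). -/
theorem J_permTest (π₀ : Equiv.Perm (Fin 4)) (F : SchwartzMap (Fin 4 → E4) ℂ) :
    J (permTest π₀ F) = J F := by
  rw [J_apply, J_apply]
  refine Finset.sum_congr rfl fun g _ => ?_
  simp only [permTest_apply]
  exact Fintype.sum_equiv (Equiv.mulRight π₀) _ _ fun π => rfl

/-- `J` is invariant under diagonal translations (translation invariance of Lebesgue measure on `ℝ⁷`). -/
theorem J_translate (a : E4) (F : SchwartzMap (Fin 4 → E4) ℂ) :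
    J (translateMulti a F) = J F := by
  rw [J_apply, J_apply]
  refine Finset.sum_congr rfl fun g _ => Finset.sum_congr rfl fun π _ => ?_
  simp only [translateMulti_apply]
  have key : ∀ y : D7, (fun i => sp g.1 g.2 (A y (π i)) - a) =
      fun i => sp g.1 g.2 (A (y - embed ((sp g.1 g.2).symm a)) (π i)) := by
    intro y
    funext i
    rw [map_sub, Pi.sub_apply, A_embed, map_sub, LinearIsometryEquiv.apply_symm_apply]
  simp_rw [key]
  exact integral_sub_right_eq_self (μ := (volume : Measure D7))
    (fun y => F fun i => sp g.1 g.2 (A y (π i))) _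

/-- `J` is invariant under pull-back by any signed permutation (re-indexing of the `W(B₄)`-sum). -/
theorem J_sp (τ : Equiv.Perm (Fin 4)) (δ : Fin 4 → Bool) (F : SchwartzMap (Fin 4 → E4) ℂ) :
    J (linActMulti (sp τ δ).symm F) = J F := by
  rw [J_apply, J_apply]
  simp only [linActMulti_apply, LinearIsometryEquiv.symm_symm, sp_comp_apply]
  exact Fintype.sum_equiv (shear τ δ) _ _ fun g => rfl

/-- `J` is invariant under pull-back by every isometry permuting the axes up to sign. -/
theorem J_hyper {R : E4 ≃ₗᵢ[ℝ] E4} (hR : IsHyper R) (F : SchwartzMap (Fin 4 → E4) ℂ) :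
    J (linActMulti R F) = J F := by
  obtain ⟨τ, δ, hτ⟩ := exists_sp_of_isHyper hR.symm
  have : linActMulti R F = linActMulti (sp τ δ).symm F := by
    ext x
    simp only [linActMulti_apply, LinearIsometryEquiv.symm_symm, hτ]
  rw [this, J_sp]

/-- E3 for the junk family, degreewise. -/
theorem junk_permTest (n : ℕ) (π : Equiv.Perm (Fin n)) (F : SchwartzMap (Fin n → E4) ℂ) :
    junk n (permTest π F) = junk n F := by
  rcases Nat.eq_zero_or_pos n with rfl | hn
  · rw [junk_apply_of_eq_zero rfl _ 0, junk_apply_of_eq_zero rfl F 0, permTest_apply]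
    congr 1
  · by_cases h4 : n = 4
    · subst h4
      rw [junk_four]
      exact J_permTest π F
    · simp [junk_of_ne hn.ne' h4]

/-- E3 (symmetry) for the junk family. -/
theorem junk_isSymmetric : junk.toLabelled.IsSymmetric :=
  fun n _ π F _ => junk_permTest n π F

/-- Translation invariance of the junk family (all degrees, all test functions). -/
theorem junk_translate (n : ℕ) (a : E4) (F : SchwartzMap (Fin n → E4) ℂ) :
    junk n (translateMulti a F) = junk n F := by
  rcases Nat.eq_zero_or_pos n with rfl | hn
  · rw [junk_apply_of_eq_zero rfl _ 0, junk_apply_of_eq_zero rfl F 0, translateMulti_apply]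
    congr 1
    exact Subsingleton.elim _ _
  · by_cases h4 : n = 4
    · subst h4
      rw [junk_four]
      exact J_translate a F
    · simp [junk_of_ne hn.ne' h4]

/-- Proper (indeed full) hypercubic invariance of the junk family. -/
theorem junk_hyper (n : ℕ) {R : E4 ≃ₗᵢ[ℝ] E4} (hR : IsHyper R) (F : SchwartzMap (Fin n → E4) ℂ) :
    junk n (linActMulti R F) = junk n F := by
  rcases Nat.eq_zero_or_pos n with rfl | hn
  · rw [junk_apply_of_eq_zero rfl _ 0, junk_apply_of_eq_zero rfl F 0, linActMulti_apply]
    congr 1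
    exact Subsingleton.elim _ _
  · by_cases h4 : n = 4
    · subst h4
      rw [junk_four]
      exact J_hyper hR F
    · simp [junk_of_ne hn.ne' h4]

/-- E0' (linear growth) for the junk family: `J` is a tempered distribution, the rest is `0` or `1`. -/
theorem junk_hasLinearGrowth : junk.toLabelled.HasLinearGrowth := by
  intro T
  obtain ⟨k₀, n₀, C, hC0, hC⟩ := Literature.Analysis.Distribution.exists_bound_seminorm_clm J
  refine ⟨max k₀ n₀, max C 1, 0, fun n k _ F _ => ?_⟩
  simp only [SchwingerFamily.toLabelled_apply, Real.rpow_zero, mul_one]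
  rcases Nat.eq_zero_or_pos n with rfl | hn
  · rw [junk_apply_of_eq_zero rfl F 0]
    calc ‖F 0‖ ≤ schwartzNorm (0 * max k₀ n₀) F := norm_le_schwartzNorm _ F 0
      _ ≤ max C 1 * schwartzNorm (0 * max k₀ n₀) F :=
          le_mul_of_one_le_left (schwartzNorm_nonneg _ _) (le_max_right _ _)
  · by_cases h4 : n = 4
    · subst h4
      rw [junk_four]
      have hsub : Finset.Iic (k₀, n₀) ⊆ Finset.Iic (max k₀ n₀, max k₀ n₀) :=
        Finset.Iic_subset_Iic.2 (Prod.mk_le_mk.2 ⟨le_max_left _ _, le_max_right _ _⟩)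
      calc ‖J F‖ ≤ C * (Finset.Iic (k₀, n₀)).sup (schwartzSeminormFamily ℂ (Fin 4 → E4) ℂ) F := hC F
        _ ≤ C * schwartzNorm (max k₀ n₀) F := by
            gcongr
            exact Seminorm.le_def.1 (Finset.sup_mono hsub) F
        _ ≤ max C 1 * schwartzNorm (4 * max k₀ n₀) F := by
            gcongr
            · exact schwartzNorm_nonneg _ _
            · exact le_max_left _ _
            · exact schwartzNorm_mono (by omega) F
    · rw [junk_of_ne hn.ne' h4, _root_.zero_apply, norm_zero]
      exact mul_nonneg (le_trans zero_le_one (le_max_right _ _)) (schwartzNorm_nonneg _ _)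

/-! ### The rotation `R₀` -/

/-- `e_i`. -/
abbrev e (i : Fin 4) : E4 := EuclideanSpace.single i 1

/-- The unit vector `(3e₀ + 4e₁)/5`. -/
def f0 : E4 := (3 / 5 : ℝ) • e 0 + (4 / 5 : ℝ) • e 1

/-- Axis vectors are unit vectors. -/
theorem norm_e (i : Fin 4) : ‖e i‖ = 1 := by simp [e, PiLp.norm_single]

/-- `f0` is a unit vector (`9/25 + 16/25 = 1`). -/
theorem norm_f0 : ‖f0‖ = 1 := by
  have h : ‖f0‖ ^ 2 = 1 := by
    rw [EuclideanSpace.norm_sq_eq]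
    simp [f0, e, Fin.sum_univ_four]
    norm_num
  nlinarith [norm_nonneg f0]

/-- Mirror `x₁ ↦ -x₁` (normal `e₁`). -/
def ρ₁ : E4 ≃ₗᵢ[ℝ] E4 := (ℝ ∙ (e 1 - (-e 1)))ᗮ.reflection

/-- Mirror exchanging `e₀` and `f0`. -/
def ρ₂ : E4 ≃ₗᵢ[ℝ] E4 := (ℝ ∙ (e 0 - f0))ᗮ.reflection

/-- **The rotation** `R₀ = ρ₂ ∘ ρ₁` of the `(e₀,e₁)`-plane: `e₀ ↦ (3e₀+4e₁)/5`, fixing `e₂, e₃`. -/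
def R₀ : E4 ≃ₗᵢ[ℝ] E4 := ρ₁.trans ρ₂

/-- A hyperplane reflection fixes the vectors orthogonal to its normal. -/
theorem reflection_fix {z x : E4} (h : ⟪z, x⟫_ℝ = 0) : (ℝ ∙ z)ᗮ.reflection x = x :=
  Submodule.reflection_mem_subspace_eq_self ((Submodule.mem_orthogonal_singleton_iff_inner_right).2 h)

/-- Orthonormality of the axis vectors. -/
theorem inner_e_e (i j : Fin 4) : ⟪e i, e j⟫_ℝ = if i = j then 1 else 0 := by
  simp [e, EuclideanSpace.inner_single_left, PiLp.single_apply]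

/-- `ρ₁ e₀ = e₀`. -/
theorem ρ₁_e0 : ρ₁ (e 0) = e 0 :=
  reflection_fix (by rw [sub_neg_eq_add, inner_add_left, inner_e_e]; simp)

/-- `ρ₁ e₂ = e₂`. -/
theorem ρ₁_e2 : ρ₁ (e 2) = e 2 :=
  reflection_fix (by rw [sub_neg_eq_add, inner_add_left, inner_e_e]; simp)

/-- `ρ₁ e₃ = e₃`. -/
theorem ρ₁_e3 : ρ₁ (e 3) = e 3 :=
  reflection_fix (by rw [sub_neg_eq_add, inner_add_left, inner_e_e]; simp)

/-- `ρ₂ e₀ = f0` (the defining property of the second mirror). -/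
theorem ρ₂_e0 : ρ₂ (e 0) = f0 := Submodule.reflection_sub (by rw [norm_e, norm_f0])

/-- `ρ₂ e₂ = e₂`. -/
theorem ρ₂_e2 : ρ₂ (e 2) = e 2 :=
  reflection_fix (by simp [f0, inner_sub_left, inner_add_left, real_inner_smul_left, inner_e_e])

/-- `ρ₂ e₃ = e₃`. -/
theorem ρ₂_e3 : ρ₂ (e 3) = e 3 :=
  reflection_fix (by simp [f0, inner_sub_left, inner_add_left, real_inner_smul_left, inner_e_e])

/-- `R₀ e₀ = (3e₀ + 4e₁)/5`. -/
theorem R₀_e0 : R₀ (e 0) = f0 := by simp [R₀, ρ₁_e0, ρ₂_e0]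

/-- `R₀` fixes `e₂`. -/
theorem R₀_e2 : R₀ (EuclideanSpace.single 2 1) = EuclideanSpace.single 2 1 := by
  simpa [e] using (show R₀ (e 2) = e 2 by simp [R₀, ρ₁_e2, ρ₂_e2])

/-- `R₀` fixes `e₃`. -/
theorem R₀_e3 : R₀ (EuclideanSpace.single 3 1) = EuclideanSpace.single 3 1 := by
  simpa [e] using (show R₀ (e 3) = e 3 by simp [R₀, ρ₁_e3, ρ₂_e3])

/-- A hyperplane reflection of `ℝ⁴` has determinant `-1`. -/
theorem det_reflection_hyperplane {z : E4} (hz : z ≠ 0) :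
    LinearMap.det ((ℝ ∙ z)ᗮ.reflection.toLinearEquiv : E4 →ₗ[ℝ] E4) = -1 := by
  rw [Submodule.det_reflection, Submodule.orthogonal_orthogonal, finrank_span_singleton hz, pow_one]

/-- `R₀` has determinant `1` (product of two hyperplane reflections). -/
theorem R₀_det : LinearMap.det (R₀.toLinearEquiv : E4 →ₗ[ℝ] E4) = 1 := by
  have h1 : (e 1 - (-e 1) : E4) ≠ 0 := by
    intro h
    have := congrArg (fun v : E4 => v 1) h
    simp [e] at this
  have h2 : (e 0 - f0 : E4) ≠ 0 := by
    intro h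
    have := congrArg (fun v : E4 => v 0) h
    simp [e, f0] at this
    norm_num at this
  rw [R₀, LinearIsometryEquiv.toLinearEquiv_trans, LinearEquiv.coe_trans, LinearMap.det_comp, ρ₁, ρ₂,
    det_reflection_hyperplane h1, det_reflection_hyperplane h2]
  norm_num

end Summit.QuantumFields.YangMills.Theorems.NPointIsotropy.Negative

end
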